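import Mathlib
import Summits.KontsevichZagierPeriods.KontsevichZagierPeriods.Theses.SymplecticScissors
import Literature.NumberTheory.Transcendental.KZCalculusProofs
import Literature.NumberTheory.Transcendental.SemialgebraicMapsProofs

/-!
# `VolumeForm` (stmt-KontsevichZagierPeriods-3814), line `Sketch` — stub `stub_stackSector`

The SECTOR THEOREM of the ruled-stacks line, as pure glue. Hypotheses: (i) *stack reduction* —
every triangular stack `r` in `ℝ³` (the solid swept by an open non-degenerate triangle whose three
vertices are `ℚ`-semialgebraic `C¹` curves of the sweep parameter `t ∈ (a, b)`, integrand `1`) is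
KZ-equivalent to an integrand-`1` planar representation `s` on the subgraph
`{(t, y) | a < t < b, 0 < y < |det M(t)| / 2}` of half its slice determinant, and such an `s`
exists; (ii) the planar layer `PlanarAreas` (stmt-4990): two planar integrand-`1` representations
with the same value are KZ-equivalent. Conclusion: two triangular stacks of equal volume are
KZ-equivalent.

Proof: reduce both stacks `r ↝ s`, `r' ↝ s'`; by soundness of the calculus
(`KZ.Equivalent.value_eq_holds`) `s.value = r.value = r'.value = s'.value`, so `s ∼ s'` by
`PlanarAreas`, and `r ∼ s ∼ s' ∼ r'` by transitivity/symmetry of `KZ.Equivalent`.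

Sources: M. Kontsevich, D. Zagier, *Periods* (2001), §1.2 (rules (1)–(3), soundness); the rest is
bookkeeping (folklore).
-/

noncomputable section

open Set MeasureTheory MvPolynomial
open Literature.NumberTheory.Transcendental

namespace Summit.KontsevichZagierPeriods.SymplecticScissors.VolumeForm

open Summit.KontsevichZagierPeriods.KontsevichZagierPeriods.Theses.SymplecticScissors (PlanarAreas)

/-- **Stack sector** (glue): given stack reduction and the planar layer `PlanarAreas`
(stmt-4990), two triangular stacks of equal volume are KZ-equivalent (reduce both, compare the two
planar subgraphs by `PlanarAreas` — their values agree by soundness `KZ.Equivalent.value_eq_holds` —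
and chain by transitivity). [Kontsevich–Zagier 2001, §1.2; folklore] -/
theorem stub_stackSector :
    (∀ (a b : ℝ) (v : Fin 3 → ℝ → Fin 2 → ℝ) (r : KZ.IntegralRep 3),
      a < b →
      (∀ j, IsSemialgebraicMapOn ℚ {z : Fin 1 → ℝ | z 0 ∈ Set.Ioo a b} (fun z => v j (z 0))) →
      (∀ j, ContDiffOn ℝ 1 (v j) (Set.Ioo a b)) →
      (∀ t ∈ Set.Ioo a b, (v 1 t 0 - v 0 t 0) * (v 2 t 1 - v 0 t 1)
        - (v 1 t 1 - v 0 t 1) * (v 2 t 0 - v 0 t 0) ≠ 0) →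
      r.domain = {p | p 0 ∈ Set.Ioo a b ∧ ∃ l m : ℝ, 0 < l ∧ 0 < m ∧ l + m < 1 ∧
        p 1 = v 0 (p 0) 0 + l * (v 1 (p 0) 0 - v 0 (p 0) 0) + m * (v 2 (p 0) 0 - v 0 (p 0) 0) ∧
        p 2 = v 0 (p 0) 1 + l * (v 1 (p 0) 1 - v 0 (p 0) 1) + m * (v 2 (p 0) 1 - v 0 (p 0) 1)} →
      (∀ p ∈ r.domain, r.integrand p = 1) →
      ∃ s : KZ.IntegralRep 2,
        s.domain = {q | q 0 ∈ Set.Ioo a b ∧ 0 < q 1 ∧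
          q 1 < |(v 1 (q 0) 0 - v 0 (q 0) 0) * (v 2 (q 0) 1 - v 0 (q 0) 1)
            - (v 1 (q 0) 1 - v 0 (q 0) 1) * (v 2 (q 0) 0 - v 0 (q 0) 0)| / 2} ∧
        (∀ q ∈ s.domain, s.integrand q = 1) ∧ KZ.Equivalent r s) →
    PlanarAreas →
    ∀ (a b : ℝ) (v : Fin 3 → ℝ → Fin 2 → ℝ) (a' b' : ℝ) (v' : Fin 3 → ℝ → Fin 2 → ℝ)
      (r r' : KZ.IntegralRep 3),
      a < b →
      (∀ j, IsSemialgebraicMapOn ℚ {z : Fin 1 → ℝ | z 0 ∈ Set.Ioo a b} (fun z => v j (z 0))) →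
      (∀ j, ContDiffOn ℝ 1 (v j) (Set.Ioo a b)) →
      (∀ t ∈ Set.Ioo a b, (v 1 t 0 - v 0 t 0) * (v 2 t 1 - v 0 t 1)
        - (v 1 t 1 - v 0 t 1) * (v 2 t 0 - v 0 t 0) ≠ 0) →
      r.domain = {p | p 0 ∈ Set.Ioo a b ∧ ∃ l m : ℝ, 0 < l ∧ 0 < m ∧ l + m < 1 ∧
        p 1 = v 0 (p 0) 0 + l * (v 1 (p 0) 0 - v 0 (p 0) 0) + m * (v 2 (p 0) 0 - v 0 (p 0) 0) ∧
        p 2 = v 0 (p 0) 1 + l * (v 1 (p 0) 1 - v 0 (p 0) 1) + m * (v 2 (p 0) 1 - v 0 (p 0) 1)} →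
      (∀ p ∈ r.domain, r.integrand p = 1) →
      a' < b' →
      (∀ j, IsSemialgebraicMapOn ℚ {z : Fin 1 → ℝ | z 0 ∈ Set.Ioo a' b'} (fun z => v' j (z 0))) →
      (∀ j, ContDiffOn ℝ 1 (v' j) (Set.Ioo a' b')) →
      (∀ t ∈ Set.Ioo a' b', (v' 1 t 0 - v' 0 t 0) * (v' 2 t 1 - v' 0 t 1)
        - (v' 1 t 1 - v' 0 t 1) * (v' 2 t 0 - v' 0 t 0) ≠ 0) →
      r'.domain = {p | p 0 ∈ Set.Ioo a' b' ∧ ∃ l m : ℝ, 0 < l ∧ 0 < m ∧ l + m < 1 ∧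
        p 1 = v' 0 (p 0) 0 + l * (v' 1 (p 0) 0 - v' 0 (p 0) 0) + m * (v' 2 (p 0) 0 - v' 0 (p 0) 0) ∧
        p 2 = v' 0 (p 0) 1 + l * (v' 1 (p 0) 1 - v' 0 (p 0) 1) + m * (v' 2 (p 0) 1 - v' 0 (p 0) 1)} →
      (∀ p ∈ r'.domain, r'.integrand p = 1) →
      r.value = r'.value → KZ.Equivalent r r' := by
  intro hSR hP a b v a' b' v' r r' hab hsa hc hdet hdom h1 hab' hsa' hc' hdet' hdom' h1' hv
  obtain ⟨s, _hsd, hs1, hrs⟩ := hSR a b v r hab hsa hc hdet hdom h1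
  obtain ⟨s', _hsd', hs1', hrs'⟩ := hSR a' b' v' r' hab' hsa' hc' hdet' hdom' h1'
  have hrsv : r.value = s.value := KZ.Equivalent.value_eq_holds hrs
  have hrsv' : r'.value = s'.value := KZ.Equivalent.value_eq_holds hrs'
  have hsv : s.value = s'.value := by rw [← hrsv, ← hrsv', hv]
  have hss' : KZ.Equivalent s s' := hP s s' hs1 hs1' hsv
  exact hrs.trans (hss'.trans hrs'.symm)

end Summit.KontsevichZagierPeriods.SymplecticScissors.VolumeForm

end
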